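import Summits.CriticalPhenomena.Ising3DConformalLimit.Theses.PerfectScreening
import Summits.CriticalPhenomena.Ising3DConformalLimit.Theses.IsingEuclidUpgrade
import Summits.CriticalPhenomena.Ising3DConformalLimit.Theorems.PerfectScreeningGaussianLimitIsCoulombRenormalisation
import Summits.CriticalPhenomena.Ising3DConformalLimit.Theorems.PerfectScreeningGaussianLimitIsCoulombDischarge
import Summits.CriticalPhenomena.Ising3DConformalLimit.Theorems.HyperoctahedralRPTwoPointLimitIsotropicHolds
import Summits.CriticalPhenomena.Ising3DConformalLimit.Theorems.RotationUpgradeFromTwoPoint.Negative.AutomaticOrders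
import Summits.CriticalPhenomena.Ising3DConformalLimit.Theorems.EnergyNotSigmaSquaredMoebiusLimitExistsWickPowerMoebius
import Summits.CriticalPhenomena.Ising3DConformalLimit.Theorems.MoebiusLimitExists.Negative.PinnedRenormalisation
import Summits.CriticalPhenomena.Ising3DConformalLimit.Theorems.GaussianLimitNotScreened.Negative.Reformulation
import HarnessLib

/-!
# `PerfectScreening.GaussianLimitIsCoulomb` (item stmt-CriticalPhenomena-1343): the conformal
# hypothesis is IDLE — every Gaussian pointwise limit of the critical `ℤ³` correlators is Möbius

THEOREM-ONLY file (no definitions, no named facts), `--supports stmt-CriticalPhenomena-1343`, fourth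
of the series after `…Reductions.lean`, `…Renormalisation.lean`, `…Discharge.lean`.

The item quantifies over NON-DEGENERATE, MÖBIUS-COVARIANT pointwise scaling limits `(ρ, Δ, S)` of
`criticalCorr 3` with `U₄ ≡ 0` on non-coincident quadruples and concludes the lattice Coulomb bound
`∃ c > 0, ∀ x ≠ 0, c/‖x‖ ≤ ⟨σ₀σ_x⟩_{β_c}`. This file proves that the whole conformal package
`IsMoebiusCovariant Δ S` carries NO information for such limits, by assembling four theorems of the
tree that landed for other items of the sub-problem:

* translations are automatic for every pointwise limit (`translation_redundant`, crux 8367 disprover,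
  from `MoebiusLimitExistsNegative.limit_translate`: the plus state at `β_c` is shift invariant);
* dilation covariance with SOME `Δ' ∈ [1/2, 1]` is automatic for every non-degenerate pointwise limit
  (`scale_redundant`, from `MoebiusLimitExistsNegative.exists_scaleCovariant_on_nonCoincident`:
  Messager–Miracle-Solé + Cauchy's equation), and `Δ' ≤ 3/4` (`dimension_window_and_eta`,
  Duminil-Copin–Panis 2025 Thm 1.5);
* **two-point isotropy is a THEOREM** (`HyperoctahedralRPTwoPoint.twoPointLimitIsotropic_proof`, item
  stmt-1984 of route HyperoctahedralRP, closed: nine-mirror reflection positivity of the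
  critical state passed to the limit + the rigidity crux `HRP2Rigidity`, item stmt-1979, closed): for a
  translation-invariant scale-covariant non-degenerate limit, `S₂(0, R x) = S₂(0, x)` for all `R ∈ O(3)`;
* for a GAUSSIAN limit the Aizenman–Newman dichotomy
  (`HasPointwiseScalingLimit.eq_pairingSum_of_limitConnectedFour_eq_zero`, Aizenman 1982 Prop. 12.1 in
  the limit) makes every `S_{2m}` the Wick sum of the round pure power `A‖p − q‖^{-2Δ'}`, i.e.
  `S = (√A)ⁿ · W_{Δ'}` on non-coincident configurations, and the Wick family `W_{Δ'} = wickPower Δ'` is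
  Möbius covariant for every `Δ'` (`stub_wickPowerMoebius`, line `only-interaction-breaks-moebius` of
  crux 1344; rotations: `isRotationInvariant_of_gaussian`).

Results (all sorry-free, standard axioms):

* §1 `gaussian_normalised_eq_gff`, `isMoebiusCovariant_of_gaussian_normalised`,
  `exists_moebius_normalisation_of_gaussian` — **every non-degenerate pointwise scaling limit of
  `criticalCorr 3` (any `ρ > 0` on `(0,1]`, NO symmetry assumed) with `U₄ ≡ 0` off the diagonals is, on
  non-coincident configurations, the generalised free field `(√A)ⁿ W_{Δ'}` for some `Δ' ∈ [1/2, 3/4]`,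
  `A = S₂(0,e₀) > 0`; its normalisation is Möbius covariant with dimension `Δ'`.**
* §2 `gaussianLimitIsCoulomb_iff_core` — the item is EQUIVALENT to its symmetry-free core
  "`ρ > 0`, pointwise limit, non-degenerate, `U₄ ≡ 0` on `NonCoincident 3 4` ⇒ Coulomb bound";
  `gaussianLimitIsCoulomb_iff_core_renormalisation` — equivalently "every such Gaussian limit is reached
  with `δ·ρ(δ)²` bounded" (with `renormalisation_lower_bound`: `ρ(δ)² ≍ δ⁻¹`, the canonical `Z ∈ (0,∞)`).
* §3 `gaussianLimitIsCoulomb_iff_nonSaturation_imp_r4NonGaussian` — **the item is LITERALLY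
  `NonSaturation → IsingEuclidUpgradeR4NonGaussian`** (items 1342 and 0636 of the tree, verbatim):
  "the weakest form of `η > 0` forces every non-degenerate pointwise scaling limit of the critical `ℤ³`
  correlators to interact". Hence `gaussianLimitIsCoulomb_iff_r4NonGaussian_of_nonSaturation`: in the
  physical regime `NonSaturation` (`η(3) ≈ 0.036 > 0`) item 1343 and crux 0636 are the SAME
  statement; and `gaussianLimitIsCoulomb_iff_not_nonSaturation_or`.
* §4 the same surgery on the route's crux r4: `gaussianLimitNotScreened_iff_core`,
  `gaussianLimitNotScreened_iff_screened_imp_r4NonGaussian` — crux 13886 is LITERALLY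
  "perfect screening `‖x‖⟨σ₀σ_x⟩_{β_c} → 0` ⇒ `IsingEuclidUpgradeR4NonGaussian`".
* §6 (appended) `coulombImpliesNontrivial_and_notScreened_iff_r4NonGaussian` and its two discharges —
  given the screening dichotomy (a theorem under `SubharmonicOffOrigin`, 1341, or `EventuallySubharmonic`,
  13887), **the route's two limit cruxes r3 ∧ r4 are EQUIVALENT to crux 0636**: route PerfectScreening is
  exactly the case split of `IsingEuclidUpgradeR4NonGaussian` along Coulomb-or-screened.
* §5 `r4NonGaussian_or_moebiusLimitExists` — a free dividend for the sub-problem: **crux 0636 OR crux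
  1344 holds outright** (if some non-degenerate pointwise limit is Gaussian, its normalisation is a
  Möbius-covariant non-degenerate limit with `Δ' ≥ 1/2 > 0`): "the critical Ising model on `ℤ³` is
  non-trivial or has a conformally covariant scaling limit" is a theorem of the tree.

Consequence for the planner (release note): item 1343 cannot be moved by any limit-side symmetry
argument (Newman / Markov inheritance / Pitt–Kotani act on an object that is ALREADY the generalised
free field `W_{Δ'}`); modulo the lattice statement `NonSaturation` it IS crux 0636, on which it is
therefore blocked.

References: M. Aizenman, Comm. Math. Phys. 86 (1982) 1–48, Prop. 12.1; C. M. Newman, Comm. Math.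
Phys. 41 (1975) 1–9; J. Fröhlich, R. Israel, E. H. Lieb, B. Simon, Comm. Math. Phys. 62 (1978) 1–34
(reflection positivity in lattice planes); H. Duminil-Copin, ICM 2022 §8.1 (rotation invariance on
`ℤ³` listed open); H. Duminil-Copin, R. Panis, arXiv:2404.05700 Thm 1.5; P. Di Francesco, P. Mathieu,
D. Sénéchal, *Conformal Field Theory* (1997) §4.3.1 eq. (4.62).
-/

noncomputable section

namespace Summit.CriticalPhenomena.Ising3DConformalLimit.PerfectScreeningGaussianLimitIsCoulomb

open Literature.Probability.LatticeModels Filter Set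
open scoped Topology
open Summit.CriticalPhenomena.Ising3DConformalLimit.Theses
open Summit.CriticalPhenomena.Ising3DConformalLimit.MoebiusLimitExistsNegative
  (normalised_hasLimit normalised_nondeg hasNontrivialU4_normalised_iff isMoebiusCovariant_pow_mul)
open Summit.CriticalPhenomena.Ising3DConformalLimit.MoebiusLimitExistsOnlyInteraction
  (wickPower powerKernel wickPower_of_mem_even wickPower_two wickPower_zero wickPower_of_odd
    wickPower_of_not_mem stub_wickPowerMoebius)
open Summit.CriticalPhenomena.Ising3DConformalLimit.RotationUpgradeFromTwoPointNegative
  (translation_redundant scale_redundant isRotationInvariant_of_gaussian two_point_law)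
open Summit.CriticalPhenomena.Ising3DConformalLimit.InversionUpgradeNormalisedNegative
  (limit_odd_eq_zero limit_zero_eq_one)
open Literature.Barriers.CriticalPhenomena.ScaleNotMoebius (axisUnit)

/-! ### §1 A Gaussian pointwise limit of the critical `ℤ³` correlators is a generalised free field -/

section Normalised

variable {ρ : ℝ → ℝ} {S : CorrFamily 3}

/-- **A normalised Gaussian pointwise limit IS the generalised free field.** Let `S` be a pointwise
scaling limit of `criticalCorr 3` along a renormalisation `ρ > 0` on `(0,1]`, normalised (`S = 0` off
`NonCoincident`), with non-degenerate two-point function and `U₄ ≡ 0` on non-coincident quadruples.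
Then for some `Δ' ∈ [1/2, 3/4]`, `S` is scale covariant with dimension `Δ'` and
`S n x = (√A)ⁿ · W_{Δ'} n x` for ALL `n` and `x`, where `A = S₂(0, e₀) > 0` and `W_{Δ'} = wickPower Δ'`
is the normalised Wick family of `‖p − q‖^{-2Δ'}`. Ingredients: free translations and dilations,
two-point isotropy (`twoPointLimitIsotropic_proof`, nine-mirror RP rigidity), the two-point law
`S₂(a,b) = A‖a−b‖^{-2Δ'}`, and the Aizenman–Newman dichotomy at even orders `≥ 4`; order `0` is
`⟨1⟩ = 1`, odd orders vanish (`m*(β_c) = 0`). [cite: AizenmanCMP1982, Prop. 12.1] -/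
theorem gaussian_normalised_eq_gff (hρ : ∀ δ ∈ Set.Ioc (0:ℝ) 1, 0 < ρ δ)
    (hlim : HasPointwiseScalingLimit (criticalCorr 3) ρ S)
    (hnorm : ∀ n z, z ∉ NonCoincident 3 n → S n z = 0) (hnd : IsNondegenerateTwoPoint S)
    (hU : ∀ z ∈ NonCoincident 3 4, limitConnectedFour S z = 0) :
    ∃ Δ' ∈ Set.Icc (1 / 2 : ℝ) (3 / 4), IsScaleCovariant Δ' S ∧
      ∀ (n : ℕ) (x : Fin n → EuclideanSpace ℝ (Fin 3)),
        S n x = Real.sqrt (S 2 ![0, axisUnit]) ^ n * wickPower Δ' n x := by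
  have htr : IsTranslationInvariant S := translation_redundant hlim hnorm
  obtain ⟨Δ', -, hsc⟩ := scale_redundant hρ hlim hnorm hnd
  have hwin := (GaussianLimitNotScreenedNegative.dimension_window_and_eta hρ hlim hnd hsc).1
  -- two-point isotropy: THEOREM of the tree (route HyperoctahedralRP, item stmt-1984)
  have hiso : ∀ (R : EuclideanSpace ℝ (Fin 3) ≃ₗᵢ[ℝ] EuclideanSpace ℝ (Fin 3))
      (x : EuclideanSpace ℝ (Fin 3)), x ≠ 0 → S 2 ![0, R x] = S 2 ![0, x] :=
    HyperoctahedralRPTwoPoint.twoPointLimitIsotropic_proof ρ Δ' S hρ hlim hnd htr hsc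
  set A : ℝ := S 2 ![0, axisUnit] with hA
  have hApos : 0 < A := hnd _ (zero_unitVec_mem_nonCoincident (t := (1 : ℝ)) one_ne_zero)
  have hsqrt : ∀ m : ℕ, Real.sqrt A ^ (2 * m) = A ^ m := fun m => by
    rw [pow_mul, Real.sq_sqrt hApos.le]
  -- the two-point law at distinct points
  have h2 : ∀ a b : EuclideanSpace ℝ (Fin 3), a ≠ b → S 2 ![a, b] = A * powerKernel Δ' a b := by
    intro a b hab
    rw [two_point_law htr hsc hiso hab, mul_comm]
    rfl
  refine ⟨Δ', hwin, hsc, fun n x => ?_⟩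
  by_cases hx : x ∈ NonCoincident 3 n
  · have hinj : Function.Injective x := hx
    rcases Nat.even_or_odd n with hev | hodd
    · by_cases h4 : 4 ≤ n
      · obtain ⟨m, rfl⟩ : ∃ m, n = 2 * m := by
          obtain ⟨r, hr⟩ := hev
          exact ⟨r, by omega⟩
        have hm2 : 2 ≤ m := by omega
        rw [hsqrt m, wickPower_of_mem_even hx,
          hlim.eq_pairingSum_of_limitConnectedFour_eq_zero le_rfl hU hm2 hx]
        exact PairIsing.pairingSum_eq_pow_mul (powerKernel Δ') (fun p q => S 2 ![p, q]) A m x x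
          (fun i j hij => h2 _ _ (hinj.ne hij))
      · interval_cases n
        · rw [limit_zero_eq_one hlim x, wickPower_zero, pow_zero, one_mul]
        · exact absurd hev (by decide)
        · have ex : S 2 x = S 2 ![x 0, x 1] := by
            congr 1; funext i; fin_cases i <;> rfl
          rw [ex, h2 _ _ (hinj.ne (by decide : (0 : Fin 2) ≠ 1)), wickPower_two hx,
            Real.sq_sqrt hApos.le]
          rfl
        · exact absurd hev (by decide)
    · rw [limit_odd_eq_zero hlim hnorm hodd x, wickPower_of_odd hodd, mul_zero]
  · rw [hnorm n x hx, wickPower_of_not_mem hx, mul_zero]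

/-- **A normalised Gaussian pointwise limit is Möbius covariant**, with a dimension
`Δ' ∈ [1/2, 3/4]`: no rotation, dilation or inversion hypothesis is needed
(`gaussian_normalised_eq_gff` + Möbius covariance of `(√A)ⁿ W_{Δ'}`, `stub_wickPowerMoebius`,
`isMoebiusCovariant_pow_mul`). [cite: FrancescoMathieuSenechal1997, §4.3.1 eq. (4.62)] -/
theorem isMoebiusCovariant_of_gaussian_normalised (hρ : ∀ δ ∈ Set.Ioc (0:ℝ) 1, 0 < ρ δ)
    (hlim : HasPointwiseScalingLimit (criticalCorr 3) ρ S)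
    (hnorm : ∀ n z, z ∉ NonCoincident 3 n → S n z = 0) (hnd : IsNondegenerateTwoPoint S)
    (hU : ∀ z ∈ NonCoincident 3 4, limitConnectedFour S z = 0) :
    ∃ Δ' ∈ Set.Icc (1 / 2 : ℝ) (3 / 4), IsMoebiusCovariant Δ' S := by
  obtain ⟨Δ', hwin, -, hS⟩ := gaussian_normalised_eq_gff hρ hlim hnorm hnd hU
  refine ⟨Δ', hwin, ?_⟩
  have hM := isMoebiusCovariant_pow_mul (Real.sqrt (S 2 ![0, axisUnit])) (stub_wickPowerMoebius Δ')
  have e : (fun (n : ℕ) (x : Fin n → EuclideanSpace ℝ (Fin 3)) =>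
      Real.sqrt (S 2 ![0, axisUnit]) ^ n * wickPower Δ' n x) = S := by
    funext n x
    exact (hS n x).symm
  rwa [e] at hM

end Normalised

open Classical in
/-- **Normalising a Gaussian limit.** For ANY non-degenerate pointwise scaling limit `S` of
`criticalCorr 3` along `ρ > 0` with `U₄ ≡ 0` on non-coincident quadruples (no symmetry, no
normalisation assumed), the normalised family `N` (`= S` on `NonCoincident`, `0` elsewhere) is a
pointwise limit along the SAME `ρ`, non-degenerate, Möbius covariant with some `Δ' ∈ [1/2, 3/4]`, and
Gaussian (`¬ HasNontrivialU4 N`). [folklore] -/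
theorem exists_moebius_normalisation_of_gaussian {ρ : ℝ → ℝ} {S : CorrFamily 3}
    (hρ : ∀ δ ∈ Set.Ioc (0:ℝ) 1, 0 < ρ δ) (hlim : HasPointwiseScalingLimit (criticalCorr 3) ρ S)
    (hnd : IsNondegenerateTwoPoint S) (hU : ∀ z ∈ NonCoincident 3 4, limitConnectedFour S z = 0) :
    ∃ (Δ' : ℝ) (N : CorrFamily 3), Δ' ∈ Set.Icc (1 / 2 : ℝ) (3 / 4) ∧
      HasPointwiseScalingLimit (criticalCorr 3) ρ N ∧ IsNondegenerateTwoPoint N ∧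
      IsMoebiusCovariant Δ' N ∧ ¬ HasNontrivialU4 N ∧
      ∀ n, ∀ x ∈ NonCoincident 3 n, N n x = S n x := by
  set N : CorrFamily 3 := fun n x => if x ∈ NonCoincident 3 n then S n x else 0 with hN
  have hnormN : ∀ n z, z ∉ NonCoincident 3 n → N n z = 0 := fun n z hz => if_neg hz
  have hlimN : HasPointwiseScalingLimit (criticalCorr 3) ρ N := normalised_hasLimit hlim
  have hndN : IsNondegenerateTwoPoint N := normalised_nondeg hnd
  have hU4N : ¬ HasNontrivialU4 N := fun h => by
    obtain ⟨z, hz, hne⟩ := hasNontrivialU4_normalised_iff.1 h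
    exact hne (hU z hz)
  have hUN : ∀ z ∈ NonCoincident 3 4, limitConnectedFour N z = 0 := fun z hz => by
    by_contra hne
    exact hU4N ⟨z, hz, hne⟩
  obtain ⟨Δ', hwin, hM⟩ := isMoebiusCovariant_of_gaussian_normalised hρ hlimN hnormN hndN hUN
  exact ⟨Δ', N, hwin, hlimN, hndN, hM, hU4N, fun n x hx => if_pos hx⟩

/-! ### §2 The item is its symmetry-free core -/

/-- **`GaussianLimitIsCoulomb` ⇔ its CORE.** Item 1343 is equivalent to: for every renormalisation
`ρ > 0` on `(0,1]` and every pointwise scaling limit `S` of `criticalCorr 3` along `ρ` with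
non-degenerate two-point function and `U₄ ≡ 0` on non-coincident quadruples, the lattice Coulomb
bound `∃ c > 0, ∀ x ≠ 0, c/‖x‖ ≤ ⟨σ₀σ_x⟩_{β_c}` holds. The binder `Δ` and the clause
`IsMoebiusCovariant Δ S` of the item are idle (⇒: apply the item to the Möbius normalisation of
`S`, `exists_moebius_normalisation_of_gaussian`; ⇐: forget the covariance). [folklore] -/
theorem gaussianLimitIsCoulomb_iff_core :
    PerfectScreening.GaussianLimitIsCoulomb ↔
      ∀ (ρ : ℝ → ℝ) (S : CorrFamily 3), (∀ δ ∈ Set.Ioc (0:ℝ) 1, 0 < ρ δ) →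
        HasPointwiseScalingLimit (criticalCorr 3) ρ S → IsNondegenerateTwoPoint S →
        (∀ z ∈ NonCoincident 3 4, limitConnectedFour S z = 0) →
          ∃ c : ℝ, 0 < c ∧ ∀ x : Site 3, x ≠ 0 → c / ‖x‖ ≤ criticalTwoPoint 3 x := by
  constructor
  · intro h ρ S hρ hlim hnd hU
    obtain ⟨Δ', N, -, hlimN, hndN, hM, hU4N, -⟩ :=
      exists_moebius_normalisation_of_gaussian hρ hlim hnd hU
    exact h ρ Δ' N hρ hlimN hndN hM hU4N
  · intro h ρ Δ S hρ hlim hnd _hM hU4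
    exact h ρ S hρ hlim hnd fun z hz => by_contra fun hne => hU4 ⟨z, hz, hne⟩

/-- **The core in renormalisation form**: item 1343 holds iff every non-degenerate Gaussian
(`U₄ ≡ 0` off the diagonals) pointwise scaling limit of `criticalCorr 3` — no symmetry assumed — is
reached with `δ·ρ(δ)²` bounded as `δ → 0⁺` (`coulomb_iff_isBoundedUnder_renormalisation`); with
`renormalisation_lower_bound` this is the canonical free-field normalisation `ρ(δ)² ≍ δ⁻¹`. [folklore] -/
theorem gaussianLimitIsCoulomb_iff_core_renormalisation :
    PerfectScreening.GaussianLimitIsCoulomb ↔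
      ∀ (ρ : ℝ → ℝ) (S : CorrFamily 3), (∀ δ ∈ Set.Ioc (0:ℝ) 1, 0 < ρ δ) →
        HasPointwiseScalingLimit (criticalCorr 3) ρ S → IsNondegenerateTwoPoint S →
        (∀ z ∈ NonCoincident 3 4, limitConnectedFour S z = 0) →
          IsBoundedUnder (· ≤ ·) (𝓝[>] (0 : ℝ)) (fun δ : ℝ => δ * ρ δ ^ 2) := by
  rw [gaussianLimitIsCoulomb_iff_core]
  constructor
  · intro h ρ S hρ hlim hnd hU
    exact (coulomb_iff_isBoundedUnder_renormalisation hlim hnd).1 (h ρ S hρ hlim hnd hU)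
  · intro h ρ S hρ hlim hnd hU
    exact (coulomb_iff_isBoundedUnder_renormalisation hlim hnd).2 (h ρ S hρ hlim hnd hU)

/-! ### §3 The item is `NonSaturation → IsingEuclidUpgradeR4NonGaussian` -/

/-- **Item 1343 = (item 1342 ⇒ crux 0636), verbatim.** `GaussianLimitIsCoulomb` holds iff
`NonSaturation` (`∀ ε > 0, ∃ᶠ n, n·⟨σ₀σ_{n e₀}⟩_{β_c} < ε`, the weakest form of `η > 0`) implies
`IsingEuclidUpgradeR4NonGaussian` (every non-degenerate pointwise scaling limit of `criticalCorr 3`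
has `U₄ ≢ 0`). (`gaussianLimitIsCoulomb_iff_core` + `not_coulomb_iff_nonSaturation`,
Messager–Miracle-Solé.) [folklore] -/
theorem gaussianLimitIsCoulomb_iff_nonSaturation_imp_r4NonGaussian :
    PerfectScreening.GaussianLimitIsCoulomb ↔
      (PerfectScreening.NonSaturation → IsingEuclidUpgrade.IsingEuclidUpgradeR4NonGaussian) := by
  rw [gaussianLimitIsCoulomb_iff_core]
  constructor
  · intro h hNS ρ S hρ hlim hnd
    by_contra hU4
    have hU : ∀ z ∈ NonCoincident 3 4, limitConnectedFour S z = 0 :=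
      fun z hz => by_contra fun hne => hU4 ⟨z, hz, hne⟩
    exact not_coulomb_iff_nonSaturation.2 hNS (h ρ S hρ hlim hnd hU)
  · intro h ρ S hρ hlim hnd hU
    by_contra hC
    obtain ⟨z, hz, hne⟩ := h (not_coulomb_iff_nonSaturation.1 hC) ρ S hρ hlim hnd
    exact hne (hU z hz)

/-- **In the physical regime the item IS crux 0636**: under `NonSaturation` (item 1342),
`GaussianLimitIsCoulomb ↔ IsingEuclidUpgradeR4NonGaussian`. [folklore] -/
theorem gaussianLimitIsCoulomb_iff_r4NonGaussian_of_nonSaturation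
    (hNS : PerfectScreening.NonSaturation) :
    PerfectScreening.GaussianLimitIsCoulomb ↔ IsingEuclidUpgrade.IsingEuclidUpgradeR4NonGaussian := by
  rw [gaussianLimitIsCoulomb_iff_nonSaturation_imp_r4NonGaussian]
  exact ⟨fun h => h hNS, fun h _ => h⟩

/-- **Disjunctive form**: `GaussianLimitIsCoulomb ↔ (¬ NonSaturation ∨ IsingEuclidUpgradeR4NonGaussian)`
— the item holds iff EITHER the infrared bound is saturated along the axis (the Coulomb bound holds
outright, `η = 0`) OR every non-degenerate pointwise limit interacts. [folklore] -/
theorem gaussianLimitIsCoulomb_iff_not_nonSaturation_or :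
    PerfectScreening.GaussianLimitIsCoulomb ↔
      (¬ PerfectScreening.NonSaturation ∨ IsingEuclidUpgrade.IsingEuclidUpgradeR4NonGaussian) := by
  rw [gaussianLimitIsCoulomb_iff_nonSaturation_imp_r4NonGaussian, imp_iff_not_or]

/-! ### §4 The same surgery on the route's crux r4 `GaussianLimitNotScreened` (item 13886) -/

/-- **Crux r4 ⇔ its CORE**: `GaussianLimitNotScreened` holds iff every non-degenerate pointwise
scaling limit of `criticalCorr 3` (`ρ > 0` on `(0,1]`) with `U₄ ≡ 0` on non-coincident quadruples
forbids perfect screening `‖x‖·⟨σ₀σ_x⟩_{β_c} → 0`; the Möbius clause is idle. [folklore] -/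
theorem gaussianLimitNotScreened_iff_core :
    PerfectScreening.GaussianLimitNotScreened ↔
      ∀ (ρ : ℝ → ℝ) (S : CorrFamily 3), (∀ δ ∈ Set.Ioc (0:ℝ) 1, 0 < ρ δ) →
        HasPointwiseScalingLimit (criticalCorr 3) ρ S → IsNondegenerateTwoPoint S →
        (∀ z ∈ NonCoincident 3 4, limitConnectedFour S z = 0) →
          ¬ Tendsto (fun x : Site 3 => ‖x‖ * criticalTwoPoint 3 x) cofinite (𝓝 0) := by
  constructor
  · intro h ρ S hρ hlim hnd hU
    obtain ⟨Δ', N, -, hlimN, hndN, hM, hU4N, -⟩ :=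
      exists_moebius_normalisation_of_gaussian hρ hlim hnd hU
    exact h ρ Δ' N hρ hlimN hndN hM hU4N
  · intro h ρ Δ S hρ hlim hnd _hM hU4
    exact h ρ S hρ hlim hnd fun z hz => by_contra fun hne => hU4 ⟨z, hz, hne⟩

/-- **Crux 13886 = (perfect screening ⇒ crux 0636), verbatim**: `GaussianLimitNotScreened` holds iff
`‖x‖·⟨σ₀σ_x⟩_{β_c} → 0` (cofinitely on `ℤ³`) implies `IsingEuclidUpgradeR4NonGaussian`. [folklore] -/
theorem gaussianLimitNotScreened_iff_screened_imp_r4NonGaussian :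
    PerfectScreening.GaussianLimitNotScreened ↔
      (Tendsto (fun x : Site 3 => ‖x‖ * criticalTwoPoint 3 x) cofinite (𝓝 0) →
        IsingEuclidUpgrade.IsingEuclidUpgradeR4NonGaussian) := by
  rw [gaussianLimitNotScreened_iff_core]
  constructor
  · intro h hT ρ S hρ hlim hnd
    by_contra hU4
    have hU : ∀ z ∈ NonCoincident 3 4, limitConnectedFour S z = 0 :=
      fun z hz => by_contra fun hne => hU4 ⟨z, hz, hne⟩
    exact h ρ S hρ hlim hnd hU hT
  · intro h ρ S hρ hlim hnd hU hT
    obtain ⟨z, hz, hne⟩ := h hT ρ S hρ hlim hnd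
    exact hne (hU z hz)

/-! ### §5 Dividend: non-triviality OR a Möbius limit, unconditionally -/

/-- **The Gaussian alternative of the sub-problem's covariance clauses is free**: if some
non-degenerate pointwise scaling limit of `criticalCorr 3` (`ρ > 0` on `(0,1]`) is Gaussian
(`U₄ ≡ 0` off the diagonals), then `MoebiusLimitExists` (crux 1344) holds — its normalisation is a
non-degenerate Möbius-covariant pointwise limit with `Δ' ≥ 1/2 > 0`
(`exists_moebius_normalisation_of_gaussian`). [folklore] -/
theorem moebiusLimitExists_of_gaussian_limit {ρ : ℝ → ℝ} {S : CorrFamily 3}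
    (hρ : ∀ δ ∈ Set.Ioc (0:ℝ) 1, 0 < ρ δ) (hlim : HasPointwiseScalingLimit (criticalCorr 3) ρ S)
    (hnd : IsNondegenerateTwoPoint S) (hU4 : ¬ HasNontrivialU4 S) :
    PerfectScreening.MoebiusLimitExists := by
  have hU : ∀ z ∈ NonCoincident 3 4, limitConnectedFour S z = 0 :=
    fun z hz => by_contra fun hne => hU4 ⟨z, hz, hne⟩
  obtain ⟨Δ', N, hwin, hlimN, hndN, hM, -, -⟩ :=
    exists_moebius_normalisation_of_gaussian hρ hlim hnd hU
  exact ⟨ρ, Δ', N, hρ, by linarith [hwin.1], hlimN, hndN, hM⟩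

/-- **Crux 0636 ∨ crux 1344, unconditionally.** Either every non-degenerate pointwise scaling limit of
the critical `ℤ³` correlators interacts (`IsingEuclidUpgradeR4NonGaussian`), or a non-degenerate
Möbius-covariant pointwise scaling limit exists (`MoebiusLimitExists`): "the critical Ising model on
`ℤ³` is non-trivial or has a conformally covariant scaling limit". [folklore] -/
theorem r4NonGaussian_or_moebiusLimitExists :
    IsingEuclidUpgrade.IsingEuclidUpgradeR4NonGaussian ∨ PerfectScreening.MoebiusLimitExists := by
  by_cases h : IsingEuclidUpgrade.IsingEuclidUpgradeR4NonGaussian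
  · exact Or.inl h
  · refine Or.inr ?_
    by_contra hne
    refine h fun ρ S hρ hlim hnd => ?_
    by_contra hU4
    exact hne (moebiusLimitExists_of_gaussian_limit hρ hlim hnd hU4)

/-! ### §6 (appended) The route's limit cruxes r3 ∧ r4 are the two halves of crux 0636 -/

/-- **Given the screening dichotomy, r3 ∧ r4 ⇔ crux 0636.** If the critical two-point function is
Coulomb-bounded below or perfectly screened, then `CoulombImpliesNontrivial` (r3, item 13885:
Coulomb ⇒ every non-degenerate pointwise limit interacts) together with `GaussianLimitNotScreened`
(r4, item 13886 ⇔ screened ⇒ the same, `gaussianLimitNotScreened_iff_screened_imp_r4NonGaussian`)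
is EQUIVALENT to `IsingEuclidUpgradeR4NonGaussian` (item 0636). [folklore] -/
theorem coulombImpliesNontrivial_and_notScreened_iff_r4NonGaussian
    (hdich : (∃ c : ℝ, 0 < c ∧ ∀ x : Site 3, x ≠ 0 → c / ‖x‖ ≤ criticalTwoPoint 3 x) ∨
      Tendsto (fun x : Site 3 => ‖x‖ * criticalTwoPoint 3 x) cofinite (𝓝 0)) :
    (PerfectScreening.CoulombImpliesNontrivial ∧ PerfectScreening.GaussianLimitNotScreened) ↔
      IsingEuclidUpgrade.IsingEuclidUpgradeR4NonGaussian := by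
  constructor
  · rintro ⟨h3, h4⟩
    rcases hdich with hC | hT
    · exact fun ρ S hρ hlim hnd => h3 hC ρ S hρ hlim hnd
    · exact gaussianLimitNotScreened_iff_screened_imp_r4NonGaussian.1 h4 hT
  · intro h
    exact ⟨fun _ => h, gaussianLimitNotScreened_iff_screened_imp_r4NonGaussian.2 fun _ => h⟩

/-- **Under the crux r2 `SubharmonicOffOrigin` (1341): r3 ∧ r4 ⇔ 0636** (the dichotomy is the tree
theorem `screeningDichotomy_proof` fed with `GreenAsymptotics_proof`). So the deciding theorem
`Theses.PerfectScreening.closes` reads: `SubH ∧ 0636 ∧ MoebiusLimitExists ⇒ Ising3DConformalLimit`,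
with `SubH` acting only as the case split of `0636`. [folklore] -/
theorem cruxes_iff_r4NonGaussian_of_subharmonicOffOrigin
    (hSubH : PerfectScreening.SubharmonicOffOrigin) :
    (PerfectScreening.CoulombImpliesNontrivial ∧ PerfectScreening.GaussianLimitNotScreened) ↔
      IsingEuclidUpgrade.IsingEuclidUpgradeR4NonGaussian :=
  coulombImpliesNontrivial_and_notScreened_iff_r4NonGaussian
    (Theorems.PerfectScreening.screeningDichotomy_proof Theorems.GreenAsymptotics_proof hSubH)

/-- **Under the pre-filed repair `EventuallySubharmonic` (13887): r3 ∧ r4 ⇔ 0636**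
(`screeningDichotomyEventual_proof`). [folklore] -/
theorem cruxes_iff_r4NonGaussian_of_eventuallySubharmonic
    (hEv : PerfectScreening.EventuallySubharmonic) :
    (PerfectScreening.CoulombImpliesNontrivial ∧ PerfectScreening.GaussianLimitNotScreened) ↔
      IsingEuclidUpgrade.IsingEuclidUpgradeR4NonGaussian :=
  coulombImpliesNontrivial_and_notScreened_iff_r4NonGaussian
    (Theorems.PerfectScreening.screeningDichotomyEventual_proof Theorems.GreenAsymptotics_proof
      hEv)

end Summit.CriticalPhenomena.Ising3DConformalLimit.PerfectScreeningGaussianLimitIsCoulomb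

end
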